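/-
Copyright (c) 2026. All rights reserved.
Released under Apache 2.0 license as described in the file LICENSE.
Authors: abc-iut cell, prover seat abc-iut-w4-d095 (wave 4, gen 5), over the statements of abc-iut-L4-t3, the
reductions of abc-iut-w5-d097 / abc-iut-w5-d112 / abc-iut-f-101 / abc-iut-L4-t15, the MLF model of abc-iut-L4-t9 and
the id-rigidity results of abc-iut-L4-t9 / abc-iut-w4-d020 (see the imports).
-/
import Literature.AnabelianGeometry.AbsoluteAnabelian.LogFrobeniusMonoGenuineModel
import Literature.AnabelianGeometry.AbsoluteAnabelian.LogFrobeniusGenuineCoreRigid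
import Literature.AnabelianGeometry.AbsoluteAnabelian.AbsTopIII.MLFGaloisModelIdRigid
import Literature.AnabelianGeometry.AbsoluteAnabelian.AbsTopIII.BiAnabelianModelProofs
import HarnessLib

/-!
# [AbsTopIII] §5 at a SUB-MODEL: the genuine nonarchimedean / genuine mono-analytic setting parametrised by `ι : C ⥤ 𝒳`, and Cor 5.5 (v)'s total `□`-rigidity at the SLIM carrier

S. Mochizuki, *Topics in absolute anabelian geometry III: global reconstruction algorithms*, J. Math. Sci. Univ.
Tokyo 22 (2015) 939–1156 [MochizukiAbsTopIII2015]; locators = pages of the author's manuscript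
(`paper:url-5493eb38cbb7`): Def 3.1 (iii) p. 68 (the full subcategories `𝒞^{MLF-hyp} ⊇ 𝒞^{MLF-sB}` of `𝒞^{MLF}`),
Prop 3.2 (iv) p. 72 (`Aut((Π ↷ M_T))` is centre-free for pairs of hyperbolic orbicurve type), Def 5.4 (iii), (iv), (vii)
pp. 126–128 (the local vertices `λ_ν`, arrows `ι_ε`, `𝒩⊞_v`, `λ⊞_{v,ν}`, `ι⊞_{v,ε}`), Def 5.6 (ii)(b), (iii) pp. 135–136
(mono-analyticization), Cor 5.5 (i)–(v) pp. 130–132 ((v): "`D•` is totally `□`-rigid", proof p. 133: id-rigidity of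
`𝒳 = Th•_T[Z]`, i.e. Prop 3.2 (iv)), Cor 5.10 (iv)(a) p. 147.

## Why (D-0079 L-F sub-cell [AbsTop*]+[AbsAnab]; self-row «GENUINE-OVER», 2026-08-26)

This seat's settings `nonarchGenuine p` / `nonarchGenuineMono p` take `𝒳 :=` ALL of abc-iut-L4-t9's model MLF-Galois
`TF`-pairs `TFModel p` (arbitrary topological groups `Π_k ↠ G_k`).  That base is NOT id-rigid (`TFModel.not_isIdRigid`,
the sign twist), so FACT-LIST F-0155 `Cor55CoreRigid` (Cor 5.5 (v), ⟺ `IsIdRigid 𝒳` by abc-iut-w5-d112's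
`cor55CoreRigid_iff`) is REFUTED there (abc-iut-w4-d020, `nonarchGenuine(Mono)_not_cor55CoreRigid`) — whereas print's
`𝒳 = Th•_T[Z]` consists of pairs of strictly Belyi type, whose `Π` is slim, and IS id-rigid (Prop 3.2 (iv); at the model:
abc-iut-L4-t9's `TFModel.isIdRigid_slim` for the full subcategory `TFModel.Slim p` of pairs with slim `Π_k`).  This file
builds the same genuine setting OVER ANY FUNCTOR `ι : C ⥤ TFModel p` (e.g. the inclusion of a full sub-model):

* `LogFrobeniusSetting.nonarchGenuineOver p ι Vmod isArc` — `𝒳 := Up C`, `𝒩⊞_v = 𝒩_v := Up (C × 𝒞_TS)`,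
  `λ⊞_{v,ν} := (𝟭, ι ⋙ λ_ν)` (abc-iut-L4-t9's local vertices `𝒪^×_k̄`, `k̄^×`, `k̄`, `k~`, `(k̄^×)^pf` of Def 5.4 (iii) at
  `ι(x)`), `ι⊞_{v,ε} := (𝟙, ι_ε ∘ ι)` (genuine arrows, shell-arrow = the `p`-adic logarithm), mono-analytic rows GENUINE
  as in `nonarchGenuineMono p` (`ℰ⊢ := Up 𝒯𝔾` via `ι ⋙ monoGal` = `W ↦ G_w`, `𝒩⊢ := 𝒯𝔾 × 𝒞_TS` via `(Π ↷ M) ↦ (G ↷ M)`);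
  PLACEHOLDERS as there: `ℰ• := 𝒳`, `An• := 𝒳` (identity equivalences), archimedean components, `ψ := G ↦ (G ↷ pt)`;
  `𝒩` a product (print: fibred product).  At `ι = 𝟭` it has the components of `nonarchGenuineMono p`, place by place;
* `nonarchGenuineOverTS` — its `TS`-valued homotopy datum (all six arrows of Def 5.4 (iii));
* THEOREMS at every `ι`: Cor 5.10 (iv)(a) (`…_cor510MonoCores`, the rows-4→5 / 6→7 squares commute on the nose),
  Cor 5.5 (iv) sentences 1–2 (`…_cor55LogWall_and_notSimCompat`, given a nonarchimedean place and an object `x₀` of `C`: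
  `𝒪^× ↪ k̄^× ↪ k̄`, `k~ → k~` injective, `log_k̄` not — at `ι(x₀)`), Cor 5.5 (iii) `⊞`-half (`…_cor55Observables`: the
  `ι⊞`-squares commute at `ι(x)`), Cor 5.5 (i)(ii) (`…_cor55Cores_and_telecore`), and
  **Cor 5.5 (v), total `□`-rigidity: `nonarchGenuineOver_cor55CoreRigid_iff : … .Cor55CoreRigid ↔ IsIdRigid C`**;
* `nonarchGenuineOver_cor55Rigidity_iff` / `nonarchGenuineSlim_cor55Rigidity_iff` — F-0156 (`Cor55Rigidity` = F-0155 ∧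
  F-0157) reduces to `IsIdRigid C ∧` F-0157, i.e. at the slim carrier to F-0157 alone (abc-iut-w4-d020's pattern, credited);
* hence **F-0155 HOLDS at the SLIM genuine-nonarchimedean MLF carrier** `nonarchGenuineSlim p := nonarchGenuineOver p
  (TFModel.Slim p).ι` (`nonarchGenuineSlim_cor55CoreRigid`, from `TFModel.isIdRigid_slim`) — the print-shaped base —
  while it FAILS at `ι = 𝟭` (the bare model; abc-iut-w4-d020); the slim sub-model is inhabited (`slimMonoAnalytic`:
  abc-iut-L4-t9's mono-analytic object over `ℚ_p`, slim by `TFModel.isSlimGroup_galk`), so Cor 5.5 (iv) sentences 1–2 hold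
  at the slim carrier with no binder beyond a nonarchimedean place (`nonarchGenuineSlim_cor55LogWall_and_notSimCompat`).

MODEL-LEVEL (honest framing): instance at a model ≠ the printed theorem for the printed theaters; nothing here bears on
[IUTchIII] Cor. 3.12; no side taken; typed ≠ proved; model-level ≠ node-level.
-/

set_option autoImplicit false

noncomputable section

open CategoryTheory

namespace Literature.AnabelianGeometry.AbsoluteAnabelian

open AbsTopIII
open Literature.AlgebraicGeometry.Frobenioids (IsSlimGroup)

namespace LogFrobeniusSetting

variable (p : ℕ) [Fact p.Prime] {C : Type 1} [Category.{1} C] (ι : C ⥤ TFModel p)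

/-! ## Part 1. The holomorphic rows over `ι : C ⥤ 𝒳` -/

/-- `λ⊞_{v,ν} : Up C → Up (C × 𝒞_TS)`, `x ↦ (x, λ_ν(ι x))` at a nonarchimedean place (Def 5.4 (iii)/(iv) at `ι(x)`); at an
archimedean place of THIS setting the constant choice `λ_{k̄}` (PLACEHOLDER). [cite: MochizukiAbsTopIII2015, Definition 5.4 (iv) p.127] -/
def overLam : (b : Bool) → LogVertex b → (Up C ⥤ Up (C × TSObj))
  | false, ν => Up.liftF ((𝟭 C).prod' (ι ⋙ nonarchLoc p ν))
  | true, _ => Up.liftF ((𝟭 C).prod' (ι ⋙ TFModel.lamAdd p))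

/-- `ι_{v,ε}` before the twist: `(𝟙, ι_ε ∘ ι)` at a nonarchimedean place; identity at an archimedean place of THIS setting
(PLACEHOLDER). [cite: MochizukiAbsTopIII2015, Definition 5.4 (vii) p.128] -/
def overIotaCore : (b : Bool) → {ν₁ ν₂ : LogVertex b} → LogEdgeTS b ν₁ ν₂ → (overLam p ι b ν₁ ⟶ overLam p ι b ν₂)
  | false, _, _, ε => Up.liftT (NatTrans.prod' (𝟙 (𝟭 C)) (Functor.whiskerLeft ι (nonarchLocIota p ε)))
  | true, _, _, _ => 𝟙 _

/-- `Λ_ν ∘ λ = λ` for the identity log-Frobenius functor (log-coordinates). [cite: MochizukiAbsTopIII2015, Def 5.4 (vii) p. 128] -/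
theorem frobeniusTwist_id_comp_over (c : Bool) (F : Up C ⥤ Up (C × TSObj)) :
    frobeniusTwist (𝟭 (Up C)) c ⋙ F = F := by
  cases c <;> rfl

/-- `ι⊞_{v,ε}` over `ι` on `Γ⃗^⋉_v`: the canonical identification `Λ_{ν₁} ∘ λ⊞ = λ⊞` followed by `overIotaCore` of the
underlying edge. [cite: MochizukiAbsTopIII2015, Definition 5.4 (vii) p.128] -/
def overIota (b : Bool) {ν₁ ν₂ : LogVertex b} (ε : LogEdge b ν₁ ν₂) :
    frobeniusTwist (𝟭 (Up C)) ν₁.isPostLog ⋙ overLam p ι b ν₁ ⟶ overLam p ι b ν₂ :=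
  eqToHom (frobeniusTwist_id_comp_over _ _) ≫ overIotaCore p ι b ε.toTS

/-- `TS`-valued `ι_{v,ε}` over `ι` for ALL edges of `Γ⃗^log_v` (`𝒩⊞_v → 𝒩_v` is the identity in the model).
[cite: MochizukiAbsTopIII2015, Definition 5.4 (vii) p.128] -/
def overIotaTS (b : Bool) {ν₁ ν₂ : LogVertex b} (ε : LogEdgeTS b ν₁ ν₂) :
    (frobeniusTwist (𝟭 (Up C)) ν₁.isPostLog ⋙ overLam p ι b ν₁) ⋙ 𝟭 (Up (C × TSObj)) ⟶
      overLam p ι b ν₂ ⋙ 𝟭 (Up (C × TSObj)) :=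
  eqToHom (by rw [frobeniusTwist_id_comp_over]) ≫ Functor.whiskerRight (overIotaCore p ι b ε) (𝟭 _)

/-- Whiskering a canonical identification is the canonical identification. [folklore] -/
private theorem whiskerRight_eqToHom_over {D₁ D₂ D₃ : Type*} [Category D₁] [Category D₂] [Category D₃] {G G' : D₁ ⥤ D₂}
    (h : G = G') (F : D₂ ⥤ D₃) : Functor.whiskerRight (eqToHom h) F = eqToHom (by rw [h]) := by
  subst h
  simp [Functor.whiskerRight_id']

/-- On `Γ⃗^⋉_v` the `TS`-valued homotopy is `ι⊞` composed with `𝒩⊞_v → 𝒩_v`. [cite: MochizukiAbsTopIII2015, Definition 5.4 (vii) p.128] -/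
theorem overIotaTS_toTS (b : Bool) {ν₁ ν₂ : LogVertex b} (ε : LogEdge b ν₁ ν₂) :
    overIotaTS p ι b ε.toTS = Functor.whiskerRight (overIota p ι b ε) (𝟭 (Up (C × TSObj))) := by
  simp only [overIotaTS, overIota, Functor.whiskerRight_comp, whiskerRight_eqToHom_over]

/-- The space-link and post-log functors coincide (log-coordinates), at every place. [cite: MochizukiAbsTopIII2015, Cor 5.5 p. 130] -/
theorem overLam_spaceLink_eq_postLog (b : Bool) :
    overLam p ι b (LogVertex.spaceLink b) = overLam p ι b (LogVertex.postLog b) := by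
  cases b <;> rfl

/-- `λ⊞_{v,ν}` lies over the base: `(x, λ_ν(ι x)) ↦ x` is the identity. [cite: MochizukiAbsTopIII2015, Definition 5.4 (iv) p.127] -/
def overLamOver : (b : Bool) → (ν : LogVertex b) →
    (overLam p ι b ν ⋙ 𝟭 (Up (C × TSObj)) ⋙ Up.liftF (CategoryTheory.Prod.fst C TSObj) ≅ 𝟭 (Up C))
  | false, _ => NatIso.ofComponents (fun _ => Iso.refl _) (fun f => by
      erw [Category.comp_id, Category.id_comp]; rfl)
  | true, _ => NatIso.ofComponents (fun _ => Iso.refl _) (fun f => by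
      erw [Category.comp_id, Category.id_comp]; rfl)

/-- The componentwise mono-analyticization `𝒩_v → 𝒩⊢_v` over `ι`: `(x, (Π ↷ M)) ↦ (G_{ι x}, (G ↷ M))`.
[cite: MochizukiAbsTopIII2015, Definition 5.6 (iii) p.136] -/
def overMonoN : Up (C × TSObj) ⥤ Up (TopGroupObj × TSObj) :=
  Up.liftF ((ι ⋙ TFModel.monoGal p).prod TSObj.monoAn)

/-! ## Part 2. The setting over `ι` -/

/-- **The global log-Frobenius setting with GENUINE NONARCHIMEDEAN AND GENUINE MONO-ANALYTIC ROWS OVER A SUB-MODEL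
`ι : C ⥤ 𝒳`** (module docstring). [cite: MochizukiAbsTopIII2015, Definition 5.4 (iv) p.127] -/
def nonarchGenuineOver (Vmod : Type 1) (isArc : Vmod → Bool) : LogFrobeniusSetting Vmod isArc where
  X := Up C
  E := Up C
  proj := 𝟭 _
  log := 𝟭 _
  logIsoId := Iso.refl _
  logOver := Iso.refl _
  Nplus _ := Up (C × TSObj)
  N _ := Up (C × TSObj)
  forget _ := 𝟭 _
  toE _ := Up.liftF (CategoryTheory.Prod.fst C TSObj)
  lam v := overLam p ι (isArc v)
  lamOver v := overLamOver p ι (isArc v)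
  lam_spaceLink_eq_postLog v := overLam_spaceLink_eq_postLog p ι (isArc v)
  iota v _ _ ε := overIota p ι (isArc v) ε
  An := Up C
  κAn := CategoryTheory.Equivalence.refl
  φAn := 𝟭 _
  φAn_isEquivalence := inferInstance
  ηAn := Iso.refl _
  κAn₂ := CategoryTheory.Equivalence.refl
  Emono := Up TopGroupObj
  monoAn := Up.liftF (ι ⋙ TFModel.monoGal p)
  NmonoPlus _ := Up (TopGroupObj × TSObj)
  Nmono _ := Up (TopGroupObj × TSObj)
  forgetMono _ := 𝟭 _
  toEmono _ := Up.liftF (CategoryTheory.Prod.fst TopGroupObj TSObj)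
  monoNplus _ := overMonoN p ι
  monoN _ := overMonoN p ι
  monoHomotopy _ := Iso.refl _
  AnMono := Up TopGroupObj
  κAnMono := CategoryTheory.Equivalence.refl
  ψAnMono _ _ := Up.liftF ((𝟭 TopGroupObj).prod' TopGroupObj.trivialTS)

/-- The `TS`-valued homotopy datum of the setting over `ι`. [cite: MochizukiAbsTopIII2015, Definition 5.4 (vii) p.128] -/
def nonarchGenuineOverTS (Vmod : Type 1) (isArc : Vmod → Bool) : (nonarchGenuineOver p ι Vmod isArc).TSHomotopies where
  iota v _ _ ε := overIotaTS p ι (isArc v) ε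
  iota_toTS v _ _ ε := overIotaTS_toTS p ι (isArc v) ε

variable (Vmod : Type 1) (isArc : Vmod → Bool)

/-! ## Part 3. Cor 5.5 (i), (ii), (iii)⊞, (iv) and Cor 5.10 (iv)(a) over `ι` -/

/-- **Cor 5.5 (i), (ii) over `ι`** (universal theorems). [cite: MochizukiAbsTopIII2015, Cor 5.5 (i) p. 130] -/
theorem nonarchGenuineOver_cor55Cores_and_telecore [Nonempty Vmod] :
    (nonarchGenuineOver p ι Vmod isArc).Cor55Cores ∧ (nonarchGenuineOver p ι Vmod isArc).Cor55Telecore :=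
  ⟨(nonarchGenuineOver p ι Vmod isArc).cor55Cores_holds, (nonarchGenuineOver p ι Vmod isArc).cor55Telecore_holds⟩

/-- rows 4 → 5 ON THE NOSE over `ι`. [cite: MochizukiAbsTopIII2015, Cor 5.10 p. 146] -/
theorem nonarchGenuineOver_monoN_toEmono_eq (v : Vmod) :
    (nonarchGenuineOver p ι Vmod isArc).monoN v ⋙ (nonarchGenuineOver p ι Vmod isArc).toEmono v =
      (nonarchGenuineOver p ι Vmod isArc).toE v ⋙ (nonarchGenuineOver p ι Vmod isArc).monoAn := rfl

/-- The mono-analyticization homotopies are inhabited over `ι` (canonical identifications).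
[cite: MochizukiAbsTopIII2015, Cor 5.10 p. 146] -/
def nonarchGenuineOver_monoAnalyticizationHomotopies :
    (nonarchGenuineOver p ι Vmod isArc).MonoAnalyticizationHomotopies where
  toE v := eqToIso (nonarchGenuineOver_monoN_toEmono_eq p ι Vmod isArc v)
  anToE := Iso.refl _

/-- **Cor 5.10 (iv)(a) HOLDS over `ι`** (zero `Prop` binders). [cite: MochizukiAbsTopIII2015, Cor 5.10 (iv)(a) p.147] -/
theorem nonarchGenuineOver_cor510MonoCores [Nonempty Vmod] : (nonarchGenuineOver p ι Vmod isArc).Cor510MonoCores :=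
  cor510MonoCores_holds (nonarchGenuineOver_monoAnalyticizationHomotopies p ι Vmod isArc)

/-- The set-valued functor `Ψ`: the arithmetic datum `M` of the local `TS`-pair of an object `(x, (Π ↷ M))` of `𝒩_v`.
[cite: MochizukiAbsTopIII2015, Definition 5.4 (iv) p.127] -/
def overΨ : Up (C × TSObj) ⥤ Type :=
  inducedFunctor _ ⋙ CategoryTheory.Prod.snd C TSObj ⋙ AbsTopIII.TSObj.forgetM

/-- The two-path configuration of `Γ⃗^log_non` over `ι`: injective along `𝒪^× ↪ k̄^× ↪ k̄`, `k~ →(id) k~`, non-injective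
along the shell-arrow `log_k̄` (at `ι(x₀)`). [cite: MochizukiAbsTopIII2015, Definition 5.4 (iii) p.126] -/
theorem overIotaTS_twoPath (b : Bool) (hb : b = false) (νu νm νc : LogVertex b)
    (ε₁ : LogEdgeTS b νu νm) (ε₂ : LogEdgeTS b νm (LogVertex.spaceLink b))
    (ε₃ : LogEdgeTS b (LogVertex.postLog b) νc) (ε₄ : LogEdgeTS b νu νc) (x₀ : Up C) :
    Function.Injective ((overΨ (C := C)).map ((overIotaTS p ι b ε₁).app x₀) : _ → _) ∧
      Function.Injective ((overΨ (C := C)).map ((overIotaTS p ι b ε₂).app x₀) : _ → _) ∧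
        Function.Injective ((overΨ (C := C)).map ((overIotaTS p ι b ε₃).app x₀) : _ → _) ∧
          ¬ Function.Injective ((overΨ (C := C)).map ((overIotaTS p ι b ε₄).app x₀) : _ → _) := by
  subst hb
  match νu, νm, νc, ε₁, ε₂, ε₃, ε₄ with
  | _, _, _, NonarchEdge.unitsToMult, NonarchEdge.multToSpaceLink, NonarchEdge.postLogId, NonarchEdge.shell =>
    simp only [overIotaTS, NatTrans.comp_app, eqToHom_app, Functor.whiskerRight_app, Functor.id_map]
    exact ⟨TFModel.iotaUnitsToTimes_injective p (ι.obj x₀.down), TFModel.iotaTimesToAdd_injective p (ι.obj x₀.down),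
      TFModel.iotaPostLogId_injective p (ι.obj x₀.down), TFModel.iotaShell_not_injective p (ι.obj x₀.down)⟩

/-- **Cor 5.5 (iv), print-faithful sentences 1 AND 2, HOLD over `ι`** (given a nonarchimedean place and an object `x₀`
of `C`). [cite: MochizukiAbsTopIII2015, Cor 5.5 (iv) p. 131] -/
theorem nonarchGenuineOver_cor55LogWall_and_notSimCompat (v₀ : Vmod) (hv₀ : isArc v₀ = false) (x₀ : Up C) :
    (nonarchGenuineOver p ι Vmod isArc).Cor55LogWall (nonarchGenuineOverTS p ι Vmod isArc) ∧
      (nonarchGenuineOver p ι Vmod isArc).Cor55NotSimultaneouslyCompatible (nonarchGenuineOverTS p ι Vmod isArc) :=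
  (nonarchGenuineOver p ι Vmod isArc).cor55LogWall_and_notSimCompat_of_iota_injective (nonarchGenuineOverTS p ι Vmod isArc)
    v₀ hv₀ x₀ (overΨ (C := C))
    (fun νu νm νc _ _ _ ε₁ ε₂ ε₃ ε₄ => overIotaTS_twoPath p ι (isArc v₀) hv₀ νu νm νc ε₁ ε₂ ε₃ ε₄ x₀)

/-- The `ι⊞`-squares over `ι` commute at a NONARCHIMEDEAN place (the printed square of Def 5.4 (iii) at `ι(x)`,
`TFModel_iotaSquare_comm`). [cite: MochizukiAbsTopIII2015, Definition 5.4 (iii) p.126] -/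
theorem overIota_squaresCommute (b : Bool) (hb : b = false) ⦃ν₁ ν₂ ν₂' ν₃ : LogVertex b⦄
    (h₁ : ν₁.isPostLog = false) (_h₂ : ν₂.isPostLog = false) (_h₂' : ν₂'.isPostLog = false)
    (_h₃ : ν₃.isPostLog = false) (ε₁₂ : LogEdge b ν₁ ν₂) (ε₂₃ : LogEdge b ν₂ ν₃) (ε₁₂' : LogEdge b ν₁ ν₂')
    (ε₂'₃ : LogEdge b ν₂' ν₃) (X₀ : Up C)
    (m₁₂ : (overLam p ι b ν₁).obj X₀ ⟶ (overLam p ι b ν₂).obj X₀)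
    (m₂₃ : (overLam p ι b ν₂).obj X₀ ⟶ (overLam p ι b ν₃).obj X₀)
    (m₁₂' : (overLam p ι b ν₁).obj X₀ ⟶ (overLam p ι b ν₂').obj X₀)
    (m₂'₃ : (overLam p ι b ν₂').obj X₀ ⟶ (overLam p ι b ν₃).obj X₀)
    (hm₁₂ : HEq m₁₂ ((overIota p ι b ε₁₂).app X₀)) (hm₂₃ : HEq m₂₃ ((overIota p ι b ε₂₃).app X₀))
    (hm₁₂' : HEq m₁₂' ((overIota p ι b ε₁₂').app X₀)) (hm₂'₃ : HEq m₂'₃ ((overIota p ι b ε₂'₃).app X₀)) :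
    m₁₂ ≫ m₂₃ = m₁₂' ≫ m₂'₃ := by
  subst hb
  obtain ⟨e₁₂, he₁₂⟩ := ε₁₂
  obtain ⟨e₂₃, he₂₃⟩ := ε₂₃
  obtain ⟨e₁₂', he₁₂'⟩ := ε₁₂'
  obtain ⟨e₂'₃, he₂'₃⟩ := ε₂'₃
  cases e₁₂ <;> cases e₂₃ <;> cases e₁₂' <;> cases e₂'₃ <;>
    first
    | exact absurd h₁ (by decide)
    | exact False.elim he₂₃
    | (simp only [overIota, overIotaCore, LogEdge.toTS, NatTrans.comp_app, eqToHom_app,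
        heq_eqToHom_comp_iff] at hm₁₂ hm₂₃ hm₁₂' hm₂'₃
       obtain rfl := eq_of_heq hm₁₂
       obtain rfl := eq_of_heq hm₂₃
       obtain rfl := eq_of_heq hm₁₂'
       obtain rfl := eq_of_heq hm₂'₃
       first
       | rfl
       | (apply InducedCategory.hom_ext
          apply Prod.hom_ext
          · rfl
          · first
            | exact TFModel_iotaSquare_comm p (ι.obj X₀.down)
            | exact (TFModel_iotaSquare_comm p (ι.obj X₀.down)).symm))

/-- abc-iut-f-101's `IotaSquaresCommute` holds at every place over `ι`. [cite: MochizukiAbsTopIII2015, Definition 5.4 (iii) p.126] -/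
theorem nonarchGenuineOver_iotaSquaresCommute (v : Vmod) : (nonarchGenuineOver p ι Vmod isArc).IotaSquaresCommute v := by
  cases hb : isArc v
  · exact fun ν₁ ν₂ ν₂' ν₃ h₁ h₂ h₂' h₃ ε₁₂ ε₂₃ ε₁₂' ε₂'₃ X₀ m₁₂ m₂₃ m₁₂' m₂'₃ =>
      overIota_squaresCommute p ι (isArc v) hb h₁ h₂ h₂' h₃ ε₁₂ ε₂₃ ε₁₂' ε₂'₃ X₀ m₁₂ m₂₃ m₁₂' m₂'₃
  · exact (nonarchGenuineOver p ι Vmod isArc).iotaSquaresCommute_of_isArc v hb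

/-- **Cor 5.5 (iii), `⊞`-half, HOLDS over `ι`**. [cite: MochizukiAbsTopIII2015, Cor 5.5 (iii) p. 131] -/
theorem nonarchGenuineOver_cor55Observables : (nonarchGenuineOver p ι Vmod isArc).Cor55Observables :=
  (nonarchGenuineOver p ι Vmod isArc).cor55Observables_of_iotaSquaresCommute
    (nonarchGenuineOver_iotaSquaresCommute p ι Vmod isArc)

/-! ## Part 4. Cor 5.5 (v): total `□`-rigidity over `ι`, and the SLIM carrier -/

/-- **Cor 5.5 (v)'s total `□`-rigidity over `ι` is EXACTLY the id-rigidity of the base `C`** (abc-iut-w5-d112's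
`cor55CoreRigid_iff` + abc-iut-w4-d020's `isIdRigid_up_iff`). [cite: MochizukiAbsTopIII2015, Cor 5.5 (v) p. 131] -/
theorem nonarchGenuineOver_cor55CoreRigid_iff : (nonarchGenuineOver p ι Vmod isArc).Cor55CoreRigid ↔ IsIdRigid C :=
  (nonarchGenuineOver p ι Vmod isArc).cor55CoreRigid_iff.trans (isIdRigid_up_iff C)

/-- **The SLIM genuine-nonarchimedean MLF carrier**: the setting over the inclusion of abc-iut-L4-t9's full sub-model
`𝒳^slim ⊆ 𝒳` of `TF`-pairs with slim `Π_k` (the model home of print's `𝒞^{MLF-sB}_{TF} ⊆ 𝒞^{MLF-hyp}_{TF}`, Def 3.1 (iii)).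
[cite: MochizukiAbsTopIII2015, Definition 3.1 (iii) p.68] -/
abbrev nonarchGenuineSlim : LogFrobeniusSetting Vmod isArc :=
  nonarchGenuineOver p (ObjectProperty.ι _ : TFModel.Slim p ⥤ TFModel p) Vmod isArc

/-- **[AbsTopIII] Cor 5.5 (v), total `□`-rigidity (`Cor55CoreRigid`, FACT-LIST F-0155), HOLDS at the SLIM
genuine-nonarchimedean MLF carrier** — by Prop 3.2 (iv) at the model (abc-iut-L4-t9's `TFModel.isIdRigid_slim`); contrast
abc-iut-w4-d020's `nonarchGenuineMono_not_cor55CoreRigid` at the bare model (`ι = 𝟭`).  MODEL-LEVEL.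
[cite: MochizukiAbsTopIII2015, Cor 5.5 (v) p. 131] -/
theorem nonarchGenuineSlim_cor55CoreRigid : (nonarchGenuineSlim p Vmod isArc).Cor55CoreRigid :=
  (nonarchGenuineOver_cor55CoreRigid_iff p _ Vmod isArc).mpr (TFModel.isIdRigid_slim p)


/-- **F-0156 (`Cor55Rigidity` = F-0155 ∧ F-0157) over `ι`** reduces to `IsIdRigid C` and the `ℤ`-action clause F-0157
(abc-iut-w4-d020's `archGenuine_cor55Rigidity_iff` pattern). [cite: MochizukiAbsTopIII2015, Cor 5.5 (v) p. 131] -/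
theorem nonarchGenuineOver_cor55Rigidity_iff :
    (nonarchGenuineOver p ι Vmod isArc).Cor55Rigidity ↔ IsIdRigid C ∧ (nonarchGenuineOver p ι Vmod isArc).Cor55ShiftAction :=
  and_congr_left' (nonarchGenuineOver_cor55CoreRigid_iff p ι Vmod isArc)

/-- **F-0156 at the SLIM carrier is EXACTLY the `ℤ`-action clause F-0157 there** (the rigidity conjunct being proved) —
the remaining unit is abc-iut-f-102's THEOREM B lane (`Cor55ShiftAction` from `IotaOver`-type inputs).
[cite: MochizukiAbsTopIII2015, Cor 5.5 (v) p. 131] -/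
theorem nonarchGenuineSlim_cor55Rigidity_iff :
    (nonarchGenuineSlim p Vmod isArc).Cor55Rigidity ↔ (nonarchGenuineSlim p Vmod isArc).Cor55ShiftAction :=
  ⟨fun h => h.2, fun h => ⟨nonarchGenuineSlim_cor55CoreRigid p Vmod isArc, h⟩⟩

/-- At the same slim carrier: Cor 5.5 (i), (ii), (iii)⊞, Cor 5.10 (iv)(a) hold (for `V(F_mod) ≠ ∅`), and — given a
nonarchimedean place and a slim model pair — Cor 5.5 (iv) sentences 1–2 hold. [cite: MochizukiAbsTopIII2015, Cor 5.5 p. 130] -/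
theorem nonarchGenuineSlim_cor55_cluster [Nonempty Vmod] :
    (nonarchGenuineSlim p Vmod isArc).Cor55Cores ∧ (nonarchGenuineSlim p Vmod isArc).Cor55Telecore ∧
      (nonarchGenuineSlim p Vmod isArc).Cor55Observables ∧ (nonarchGenuineSlim p Vmod isArc).Cor55CoreRigid ∧
        (nonarchGenuineSlim p Vmod isArc).Cor510MonoCores :=
  ⟨(nonarchGenuineOver_cor55Cores_and_telecore p _ Vmod isArc).1, (nonarchGenuineOver_cor55Cores_and_telecore p _ Vmod isArc).2,
    nonarchGenuineOver_cor55Observables p _ Vmod isArc, nonarchGenuineSlim_cor55CoreRigid p Vmod isArc,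
    nonarchGenuineOver_cor510MonoCores p _ Vmod isArc⟩

/-- The bare-model contrast in one line: total `□`-rigidity FAILS over `ι = 𝟭` (abc-iut-w4-d020) and HOLDS over the slim
inclusion. [cite: MochizukiAbsTopIII2015, Cor 5.5 (v) p. 131] -/
theorem cor55CoreRigid_slim_not_bare :
    (nonarchGenuineSlim p Vmod isArc).Cor55CoreRigid ∧ ¬ (nonarchGenuineOver p (𝟭 (TFModel p)) Vmod isArc).Cor55CoreRigid :=
  ⟨nonarchGenuineSlim_cor55CoreRigid p Vmod isArc,
    fun h => TFModel.not_isIdRigid p ((nonarchGenuineOver_cor55CoreRigid_iff p (𝟭 (TFModel p)) Vmod isArc).mp h)⟩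

/-- **The slim sub-model is inhabited**: abc-iut-L4-t9's mono-analytic model object over `ℚ_p` (`Π := G_{ℚ_p}`, `ε = id`)
has slim `Π` (`TFModel.isSlimGroup_galk`, the slimness of `G_k`). [cite: MochizukiAbsTopIII2015, Definition 3.1 (ii) p.67] -/
def slimMonoAnalytic : TFModel.Slim p :=
  ⟨TFModel.monoAnalytic p ⊥, TFModel.isSlimGroup_galk (TFModel.monoAnalytic p ⊥)⟩

/-- **Cor 5.5 (iv), print-faithful sentences 1 and 2, HOLD at the slim carrier** over every index set with a nonarchimedean
place (the model-pair binder discharged by `slimMonoAnalytic`). [cite: MochizukiAbsTopIII2015, Cor 5.5 (iv) p. 131] -/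
theorem nonarchGenuineSlim_cor55LogWall_and_notSimCompat (v₀ : Vmod) (hv₀ : isArc v₀ = false) :
    (nonarchGenuineSlim p Vmod isArc).Cor55LogWall
        (nonarchGenuineOverTS p (ObjectProperty.ι _ : TFModel.Slim p ⥤ TFModel p) Vmod isArc) ∧
      (nonarchGenuineSlim p Vmod isArc).Cor55NotSimultaneouslyCompatible
        (nonarchGenuineOverTS p (ObjectProperty.ι _ : TFModel.Slim p ⥤ TFModel p) Vmod isArc) :=
  nonarchGenuineOver_cor55LogWall_and_notSimCompat p _ Vmod isArc v₀ hv₀ (ULift.up (slimMonoAnalytic p))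

end LogFrobeniusSetting

end Literature.AnabelianGeometry.AbsoluteAnabelian

end
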